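import Summits.QuantumFields.YangMills.Theorems.ComplexCouplingChannelFreeEnergyWindowChannelStubExpWindowAt
import Summits.QuantumFields.YangMills.Theorems.ComplexCouplingChannelFreeEnergyWindowChannelTransportCriterion
import Summits.QuantumFields.YangMills.Theorems.ComplexCouplingChannelFreeEnergyWindowChannelTorusZeroFreeRegime
import Summits.QuantumFields.YangMills.Theorems.ComplexCouplingChannelFreeEnergyWindowChannelStubZeroFreeOfDerivBounds
import Summits.QuantumFields.YangMills.Theorems.ComplexCouplingChannelFreeEnergyWindowChannelStubReachOfCrux
import Summits.QuantumFields.YangMills.Theorems.ComplexCouplingChannelFreeEnergyWindowChannelStubCumulantRadiusOfCrux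
import Literature.MathematicalPhysics.QuantumFieldTheory.WilsonFinTorusPartitionComplex
import HarnessLib

/-!
# Structure of the crux `FreeEnergyWindowChannel`: it is exponentially thin, and its regime split is lossless

Crux `FreeEnergyWindowChannel` (stmt-QuantumFields-18842, route `ComplexCouplingChannel` of `QuantumFields/YangMills`), line
`Sketch` (transport form), layers 5–6 (lead c3).  Compositions BY NAME of landed stubs; everything here is sorry-free.

The crux: for every compact simple `G` (tree sense) and faithful unitary `r`, beyond some `β₁`, for every `β ≥ β₁` and `ρ > 0`,
an open connected `D ∋ β` through a real `x`, `|x| < ρ`, one holomorphic `f` on `D`, a constant `M` and `P₀` with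
`Z_P z ≠ 0 ∧ |log ‖Z_P z‖ + P⁴ Re f z| ≤ M` (`P ≥ P₀`, `z ∈ D`), `Z_P z = wilsonFinTorusPartitionC r.ρ z P P P P` the complex-coupling
Wilson partition function of the symmetric torus `P⁴`.

THIS FILE PROVES:
* `freeEnergyWindowChannel_iff_expWindowChannel` — **the window is exponentially thin**: the crux is EQUIVALENT to its
  exponential form, `M` replaced by `e^{-cP}` (`c > 0`) on the channel (`→`: the landed pointwise stub `stub_expWindowAt` —
  anchor pinning near `x`, a compactly contained sub-channel `stub_connectedCompactJoin`, and the exponential-rate two-constants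
  engine `stub_expDecayOnCompacts`; `←`: `e^{-cP} ≤ 1`).
* `expTorusRemainder_of_freeEnergyWindowChannel` — at real `β ≥ β₁`: `|log Z(β; P⁴) + P⁴ F| ≤ e^{-cP}` for some real `F` and
  all large `P`: the symmetric-torus finite-size free energy is exponentially small — the torus ("thermal/Casimir") input of
  the route's `HarmonicMeasureEngine` (stmt-QuantumFields-18844), paid by THIS crux alone (the engine prover's
  `torusFreeEnergy_expSmall_of_anchor_of_window` is the same bound at the point `β` with the anchor as a hypothesis; the anchor
  is proved, `complexStrongCouplingAnchor_proof`).
* `not_freeEnergyWindowChannel_of_notExpTorusRemainder` — the negative lemma with the WEAKER hypothesis "at arbitrarily large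
  `β` the remainder is not exponentially small for any `F`, any rate".
* `local_of_crux`, `local_of_cumulantRadius`, `freeEnergyWindowChannel_iff_reach_and_local`,
  `freeEnergyWindowChannel_iff_reach_and_cumulantRadius` — **the regime split is lossless**: crux ⇔ REACH ∧ LOCAL ⇔
  REACH ∧ CUMULANT RADIUS, where REACH = "for every `b` some `βs ≥ b` is joined to `0` by a `P`-uniformly zero-free open
  connected channel" (global, the non-abelian crossover content), LOCAL = "a `P`-uniform zero-free disc around every large
  real `t`", CUMULANT RADIUS = "at every large real `t` the derivatives of `s ↦ log Z_ℝ(s; P⁴)` at `t` (the cumulants of the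
  Wilson action) grow at most like `K_P n! Cⁿ` with `C` uniform in `P`" (a purely real-variable statement).  `→`: the landed
  `stub_reach_of_crux` (crux channel ∪ anchor disc), `torusZeroFree_of_crux`, `stub_cumulantRadius_of_crux` (Borel–Carathéodory
  + Cauchy on a zero-free disc); `←`: the landed regime glue `stub_torusZeroFreeRegime`, the bridge `stub_zeroFreeOfDerivBounds`
  and the transport criterion `stub_transportCriterion` (crux ⇔ bare zero-freeness T).

So every reformulation the line produced is an EQUIVALENT of the crux: T (p155289), the exponential window, REACH ∧ LOCAL,
REACH ∧ K.  What remains is physics: REACH (global Fisher-zero topology of non-abelian lattice gauge theory: does the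
zero-free component of the strong-coupling disc reach arbitrarily large couplings?) and LOCAL/K (volume-uniform analyticity
radius of the finite-volume free energy at large real coupling) — both open-problem grade; and, by the torus-constant
invariant (`Negative/TorusRemainderRigidity`), both physics-false at the admissible centre-free `G = SO(3)` modulo
`So3TorusRemainderNonvanishing`, open for simply connected `G`.

References: R. Nevanlinna, *Eindeutige analytische Funktionen* (1936) §III.2; route file
`Summits/QuantumFields/YangMills/Theses/ComplexCouplingChannel.lean`; line card `Cruxes/FreeEnergyWindowChannel/Lines/Sketch.md`.
-/

set_option autoImplicit false

noncomputable section

open scoped Topology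
open MeasureTheory Filter Set Metric Complex
open Literature.MathematicalPhysics.QuantumFieldTheory

namespace Summit.QuantumFields.YangMills.Theorems.FreeEnergyWindowChannel

/-! ## §1 The window is exponentially thin -/

/-- **`FreeEnergyWindowChannel` is equivalent to its exponential form.**  The crux holds iff for every admissible `(G, r)`,
beyond some `β₁`, every `β ≥ β₁` and `ρ > 0` admit an open connected channel `D ∋ β` through a real `x`, `|x| < ρ`, one
holomorphic `f` on `D`, a RATE `c > 0` and `P₀` with `Z_P z ≠ 0 ∧ |log ‖Z_P z‖ + P⁴ Re f z| ≤ e^{-cP}` for all `P ≥ P₀`, `z ∈ D`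
(`→`: `stub_expWindowAt` at every `β ≥ β₁`; `←`: `e^{-cP} ≤ 1`). [folklore] -/
theorem freeEnergyWindowChannel_iff_expWindowChannel :
    Summit.QuantumFields.YangMills.Theses.ComplexCouplingChannel.FreeEnergyWindowChannel ↔
    ∀ (G : Type) [Group G] [TopologicalSpace G] [IsTopologicalGroup G] [CompactSpace G] [MeasurableSpace G] [BorelSpace G], Literature.MathematicalPhysics.QuantumFieldTheory.IsCompactSimpleLieGroup G → ∀ r : Literature.MathematicalPhysics.QuantumFieldTheory.LatticeRep G,
      ∃ β₁ : ℝ, ∀ β : ℝ, β₁ ≤ β → ∀ ρ : ℝ, 0 < ρ →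
        ∃ D : Set ℂ, IsOpen D ∧ IsConnected D ∧ (β : ℂ) ∈ D ∧ (∃ x : ℝ, |x| < ρ ∧ (x : ℂ) ∈ D) ∧
          ∃ f : ℂ → ℂ, DifferentiableOn ℂ f D ∧ ∃ c : ℝ, 0 < c ∧ ∃ P₀ : ℕ, ∀ P : ℕ, P₀ ≤ P → ∀ z ∈ D,
            wilsonFinTorusPartitionC r.ρ z P P P P ≠ 0 ∧
              |Real.log ‖wilsonFinTorusPartitionC r.ρ z P P P P‖ + (P : ℝ) ^ 4 * (f z).re| ≤ Real.exp (-(c * P)) := by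
  constructor
  · intro h G _ _ _ _ _ _ hG r
    obtain ⟨β₁, hβ₁⟩ := h G hG r
    exact ⟨β₁, fun β hβ => stub_expWindowAt G hG r β (hβ₁ β hβ)⟩
  · intro h G _ _ _ _ _ _ hG r
    obtain ⟨β₁, hβ₁⟩ := h G hG r
    refine ⟨β₁, fun β hβ ρ hρ => ?_⟩
    obtain ⟨D, hDo, hDc, hβD, hx, f, hf, c, hc, P₀, hwin⟩ := hβ₁ β hβ ρ hρ
    refine ⟨D, hDo, hDc, hβD, hx, f, hf, 1, P₀, fun P hP z hz => ⟨(hwin P hP z hz).1, (hwin P hP z hz).2.trans ?_⟩⟩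
    rw [Real.exp_le_one_iff]
    nlinarith [hc, (Nat.cast_nonneg P : (0 : ℝ) ≤ P)]

/-- **The exponential torus remainder.**  Under `FreeEnergyWindowChannel`, for every admissible `(G, r)`, beyond `β₁`, at every
real `β ≥ β₁` some real `F` (the bulk free-energy density `Re f β`) and rate `c > 0` have `|log Z(β; P⁴) + P⁴ F| ≤ e^{-cP}` for
all large `P` (`Z(β; P⁴) = wilsonFinTorusPartition r.ρ β P P P P > 0` the physical symmetric-torus partition function): the
torus input of the route's `HarmonicMeasureEngine`, from crux 18842 and the proved anchor alone. [folklore] -/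
theorem expTorusRemainder_of_freeEnergyWindowChannel
    (h : Summit.QuantumFields.YangMills.Theses.ComplexCouplingChannel.FreeEnergyWindowChannel) :
    ∀ (G : Type) [Group G] [TopologicalSpace G] [IsTopologicalGroup G] [CompactSpace G] [MeasurableSpace G] [BorelSpace G], Literature.MathematicalPhysics.QuantumFieldTheory.IsCompactSimpleLieGroup G → ∀ r : Literature.MathematicalPhysics.QuantumFieldTheory.LatticeRep G,
      ∃ β₁ : ℝ, ∀ β : ℝ, β₁ ≤ β → ∃ F : ℝ, ∃ c : ℝ, 0 < c ∧ ∃ P₀ : ℕ, ∀ P : ℕ, P₀ ≤ P →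
        |Real.log (wilsonFinTorusPartition r.ρ β P P P P) + (P : ℝ) ^ 4 * F| ≤ Real.exp (-(c * P)) := by
  intro G _ _ _ _ _ _ hG r
  haveI : SecondCountableTopology G :=
    (r.continuous.isClosedEmbedding r.injective).isEmbedding.secondCountableTopology
  obtain ⟨β₁, hβ₁⟩ := (freeEnergyWindowChannel_iff_expWindowChannel.1 h) G hG r
  refine ⟨β₁, fun β hβ => ?_⟩
  obtain ⟨D, -, -, hβD, -, f, -, c, hc, P₀, hwin⟩ := hβ₁ β hβ 1 one_pos
  refine ⟨(f β).re, c, hc, P₀, fun P hP => ?_⟩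
  have hnorm : ‖wilsonFinTorusPartitionC r.ρ (β : ℂ) P P P P‖ = wilsonFinTorusPartition r.ρ β P P P P := by
    rw [wilsonFinTorusPartitionC_ofReal, Complex.norm_real, Real.norm_eq_abs,
      abs_of_pos (wilsonFinTorusPartition_pos r.continuous β P P P P)]
  have := (hwin P hP (β : ℂ) hβD).2
  rwa [hnorm] at this

/-- **Negative lemma, weak hypothesis.**  If for some admissible `(G, r)`, at arbitrarily large real `β`, for every real `F`
and every rate `c > 0` the remainder `|log Z(β; P⁴) + P⁴ F|` exceeds `e^{-cP}` for arbitrarily large `P`, then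
`FreeEnergyWindowChannel` fails. [folklore] -/
theorem not_freeEnergyWindowChannel_of_notExpTorusRemainder
    (G : Type) [Group G] [TopologicalSpace G] [IsTopologicalGroup G] [CompactSpace G] [MeasurableSpace G]
    [BorelSpace G] (hG : IsCompactSimpleLieGroup G) (r : LatticeRep G)
    (hκ : ∀ b : ℝ, ∃ β : ℝ, b ≤ β ∧ ∀ F : ℝ, ∀ c : ℝ, 0 < c → ∀ P₀ : ℕ, ∃ P : ℕ, P₀ ≤ P ∧
      Real.exp (-(c * P)) < |Real.log (wilsonFinTorusPartition r.ρ β P P P P) + (P : ℝ) ^ 4 * F|) :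
    ¬ Summit.QuantumFields.YangMills.Theses.ComplexCouplingChannel.FreeEnergyWindowChannel := by
  intro h
  obtain ⟨β₁, hβ₁⟩ := expTorusRemainder_of_freeEnergyWindowChannel h G hG r
  obtain ⟨β, hb, hno⟩ := hκ β₁
  obtain ⟨F, c, hc, P₀, hP₀⟩ := hβ₁ β hb
  obtain ⟨P, hP, hlt⟩ := hno F c hc P₀
  exact (not_lt.2 (hP₀ P hP)) hlt

/-! ## §2 The regime split is lossless -/

/-- **crux ⇒ LOCAL**: under the crux, around every large real `t` there is a `P`-uniform zero-free disc (the crux's zero-free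
open channel at `(t, 1)`, `torusZeroFree_of_crux`, contains a disc around `t`). [folklore] -/
theorem local_of_crux
    (h : Summit.QuantumFields.YangMills.Theses.ComplexCouplingChannel.FreeEnergyWindowChannel) :
    ∀ (G : Type) [Group G] [TopologicalSpace G] [IsTopologicalGroup G] [CompactSpace G] [MeasurableSpace G] [BorelSpace G], Literature.MathematicalPhysics.QuantumFieldTheory.IsCompactSimpleLieGroup G → ∀ r : Literature.MathematicalPhysics.QuantumFieldTheory.LatticeRep G,
      ∃ β₁ : ℝ, ∀ t : ℝ, β₁ ≤ t → ∃ δ : ℝ, 0 < δ ∧ ∃ P₀ : ℕ, ∀ P : ℕ, P₀ ≤ P → ∀ z ∈ Metric.ball ((t : ℝ) : ℂ) δ,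
        wilsonFinTorusPartitionC r.ρ z P P P P ≠ 0 := by
  intro G _ _ _ _ _ _ hG r
  obtain ⟨β₁, hβ₁⟩ := torusZeroFree_of_crux h G hG r
  refine ⟨β₁, fun t ht => ?_⟩
  obtain ⟨D, hDo, -, htD, -, P₀, hZ⟩ := hβ₁ t ht 1 one_pos
  obtain ⟨δ, hδ, hball⟩ := Metric.isOpen_iff.1 hDo (t : ℂ) htD
  exact ⟨δ, hδ, P₀, fun P hP z hz => hZ P hP z (hball hz)⟩

/-- **CUMULANT RADIUS ⇒ LOCAL** (hypothesis form): a volume-uniform geometric bound `|∂ⁿ log Z_ℝ(·; P⁴)(t)| ≤ K_P n! Cⁿ` at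
every large real `t` gives the `P`-uniform zero-free disc `ball t (1/C)` (the landed bridge `stub_zeroFreeOfDerivBounds`: at
real `s` the complex partition function is the positive real one). [folklore] -/
theorem local_of_cumulantRadius
    (hK : ∀ (G : Type) [Group G] [TopologicalSpace G] [IsTopologicalGroup G] [CompactSpace G] [MeasurableSpace G] [BorelSpace G], Literature.MathematicalPhysics.QuantumFieldTheory.IsCompactSimpleLieGroup G → ∀ r : Literature.MathematicalPhysics.QuantumFieldTheory.LatticeRep G,
      ∃ β₁ : ℝ, ∀ t : ℝ, β₁ ≤ t → ∃ C : ℝ, 0 < C ∧ ∃ P₀ : ℕ, ∀ P : ℕ, P₀ ≤ P → ∃ K : ℝ, ∀ n : ℕ, 1 ≤ n →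
        |iteratedDeriv n (fun s : ℝ => Real.log (wilsonFinTorusPartition r.ρ s P P P P)) t| ≤ K * n.factorial * C ^ n) :
    ∀ (G : Type) [Group G] [TopologicalSpace G] [IsTopologicalGroup G] [CompactSpace G] [MeasurableSpace G] [BorelSpace G], Literature.MathematicalPhysics.QuantumFieldTheory.IsCompactSimpleLieGroup G → ∀ r : Literature.MathematicalPhysics.QuantumFieldTheory.LatticeRep G,
      ∃ β₁ : ℝ, ∀ t : ℝ, β₁ ≤ t → ∃ δ : ℝ, 0 < δ ∧ ∃ P₀ : ℕ, ∀ P : ℕ, P₀ ≤ P → ∀ z ∈ Metric.ball ((t : ℝ) : ℂ) δ,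
        wilsonFinTorusPartitionC r.ρ z P P P P ≠ 0 := by
  intro G _ _ _ _ _ _ hG r
  haveI : SecondCountableTopology G :=
    (r.continuous.isClosedEmbedding r.injective).isEmbedding.secondCountableTopology
  obtain ⟨β₁, hKt⟩ := hK G hG r
  refine ⟨β₁, fun t ht => ?_⟩
  obtain ⟨C, hC, P₀, hP₀⟩ := hKt t ht
  refine ⟨C⁻¹, inv_pos.2 hC, P₀, fun P hP z hz => ?_⟩
  obtain ⟨K, hKn⟩ := hP₀ P hP
  set Z : ℂ → ℂ := fun w => wilsonFinTorusPartitionC r.ρ w P P P P with hZ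
  have hZd : Differentiable ℂ Z := differentiable_wilsonFinTorusPartitionC r.ρ r.continuous P P P P
  have hnorm : ∀ s : ℝ, ‖Z (s : ℂ)‖ = wilsonFinTorusPartition r.ρ s P P P P := fun s => by
    simp only [hZ, wilsonFinTorusPartitionC_ofReal, Complex.norm_real, Real.norm_eq_abs]
    exact abs_of_pos (wilsonFinTorusPartition_pos r.continuous s P P P P)
  have hreal : ∀ s : ℝ, Z (s : ℂ) = ((‖Z (s : ℂ)‖ : ℝ) : ℂ) := fun s => by
    rw [hnorm s]
    simp only [hZ, wilsonFinTorusPartitionC_ofReal]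
  have hne : ∀ s : ℝ, Z (s : ℂ) ≠ 0 := fun s => by
    rw [hreal s, Ne, Complex.ofReal_eq_zero, hnorm s]
    exact (wilsonFinTorusPartition_pos r.continuous s P P P P).ne'
  have hder : ∀ n : ℕ, 1 ≤ n → |iteratedDeriv n (fun s : ℝ => Real.log ‖Z (s : ℂ)‖) t| ≤ K * n.factorial * C ^ n := by
    intro n hn
    have hfun : (fun s : ℝ => Real.log ‖Z (s : ℂ)‖) = fun s : ℝ =>
        Real.log (wilsonFinTorusPartition r.ρ s P P P P) := funext fun s => by rw [hnorm s]
    rw [hfun]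
    exact hKn n hn
  have hzt : ‖z - (t : ℂ)‖ < C⁻¹ := by rwa [Metric.mem_ball, dist_eq_norm] at hz
  exact stub_zeroFreeOfDerivBounds Z t C K hC hZd hreal hne hder z hzt

/-- **crux ⇔ REACH ∧ LOCAL.**  `FreeEnergyWindowChannel` holds iff (REACH) for every admissible `(G, r)` and every `b` some
`βs ≥ b` is joined to `0` by an open connected channel on which `Z_P`, `P ≥ P₀`, has no zeros, AND (LOCAL) around every large
real `t` there is a `P`-uniform zero-free disc (`→`: `stub_reach_of_crux`, `local_of_crux`; `←`: the regime glue
`stub_torusZeroFreeRegime` and the transport criterion `stub_transportCriterion`). [folklore] -/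
theorem freeEnergyWindowChannel_iff_reach_and_local :
    Summit.QuantumFields.YangMills.Theses.ComplexCouplingChannel.FreeEnergyWindowChannel ↔
    ((∀ (G : Type) [Group G] [TopologicalSpace G] [IsTopologicalGroup G] [CompactSpace G] [MeasurableSpace G] [BorelSpace G], Literature.MathematicalPhysics.QuantumFieldTheory.IsCompactSimpleLieGroup G → ∀ r : Literature.MathematicalPhysics.QuantumFieldTheory.LatticeRep G,
      ∀ b : ℝ, ∃ βs : ℝ, b ≤ βs ∧ ∃ D : Set ℂ, IsOpen D ∧ IsConnected D ∧ (0 : ℂ) ∈ D ∧ ((βs : ℝ) : ℂ) ∈ D ∧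
        ∃ P₀ : ℕ, ∀ P : ℕ, P₀ ≤ P → ∀ z ∈ D, wilsonFinTorusPartitionC r.ρ z P P P P ≠ 0) ∧
    (∀ (G : Type) [Group G] [TopologicalSpace G] [IsTopologicalGroup G] [CompactSpace G] [MeasurableSpace G] [BorelSpace G], Literature.MathematicalPhysics.QuantumFieldTheory.IsCompactSimpleLieGroup G → ∀ r : Literature.MathematicalPhysics.QuantumFieldTheory.LatticeRep G,
      ∃ β₁ : ℝ, ∀ t : ℝ, β₁ ≤ t → ∃ δ : ℝ, 0 < δ ∧ ∃ P₀ : ℕ, ∀ P : ℕ, P₀ ≤ P → ∀ z ∈ Metric.ball ((t : ℝ) : ℂ) δ,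
        wilsonFinTorusPartitionC r.ρ z P P P P ≠ 0)) :=
  ⟨fun h => ⟨stub_reach_of_crux h, local_of_crux h⟩, fun h =>
    stub_transportCriterion.2 (stub_torusZeroFreeRegime h.1 h.2)⟩

/-- **crux ⇔ REACH ∧ CUMULANT RADIUS.**  `FreeEnergyWindowChannel` holds iff REACH (as above) AND, at every large real `t`, the
derivatives at `t` of the finite-volume free energies `s ↦ log Z_ℝ(s; P⁴)` obey `|∂ⁿ log Z_P(t)| ≤ K_P n! Cⁿ` (`n ≥ 1`, `P ≥ P₀`)
with `C` uniform in `P` — the layer-2 regime split of the crux into a global zero-freeness piece and a real-variable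
weak-coupling piece is an EQUIVALENCE (`→`: `stub_reach_of_crux`, `stub_cumulantRadius_of_crux`; `←`:
`local_of_cumulantRadius`, `stub_torusZeroFreeRegime`, `stub_transportCriterion`). [folklore] -/
theorem freeEnergyWindowChannel_iff_reach_and_cumulantRadius :
    Summit.QuantumFields.YangMills.Theses.ComplexCouplingChannel.FreeEnergyWindowChannel ↔
    ((∀ (G : Type) [Group G] [TopologicalSpace G] [IsTopologicalGroup G] [CompactSpace G] [MeasurableSpace G] [BorelSpace G], Literature.MathematicalPhysics.QuantumFieldTheory.IsCompactSimpleLieGroup G → ∀ r : Literature.MathematicalPhysics.QuantumFieldTheory.LatticeRep G,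
      ∀ b : ℝ, ∃ βs : ℝ, b ≤ βs ∧ ∃ D : Set ℂ, IsOpen D ∧ IsConnected D ∧ (0 : ℂ) ∈ D ∧ ((βs : ℝ) : ℂ) ∈ D ∧
        ∃ P₀ : ℕ, ∀ P : ℕ, P₀ ≤ P → ∀ z ∈ D, wilsonFinTorusPartitionC r.ρ z P P P P ≠ 0) ∧
    (∀ (G : Type) [Group G] [TopologicalSpace G] [IsTopologicalGroup G] [CompactSpace G] [MeasurableSpace G] [BorelSpace G], Literature.MathematicalPhysics.QuantumFieldTheory.IsCompactSimpleLieGroup G → ∀ r : Literature.MathematicalPhysics.QuantumFieldTheory.LatticeRep G,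
      ∃ β₁ : ℝ, ∀ t : ℝ, β₁ ≤ t → ∃ C : ℝ, 0 < C ∧ ∃ P₀ : ℕ, ∀ P : ℕ, P₀ ≤ P → ∃ K : ℝ, ∀ n : ℕ, 1 ≤ n →
        |iteratedDeriv n (fun s : ℝ => Real.log (wilsonFinTorusPartition r.ρ s P P P P)) t| ≤ K * n.factorial * C ^ n)) :=
  ⟨fun h => ⟨stub_reach_of_crux h, stub_cumulantRadius_of_crux h⟩, fun h =>
    stub_transportCriterion.2 (stub_torusZeroFreeRegime h.1 (local_of_cumulantRadius h.2))⟩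


/-- **Registered stub `stub_cruxStructure` of line `Sketch`** (layers 5–6, lead c3; the name under which the lead's skeleton
consumes this file): the crux is equivalent to its exponential form AND to REACH ∧ CUMULANT RADIUS. [folklore] -/
theorem stub_cruxStructure :
    (Summit.QuantumFields.YangMills.Theses.ComplexCouplingChannel.FreeEnergyWindowChannel ↔ ∀ (G : Type) [Group G] [TopologicalSpace G] [IsTopologicalGroup G] [CompactSpace G] [MeasurableSpace G] [BorelSpace G], Literature.MathematicalPhysics.QuantumFieldTheory.IsCompactSimpleLieGroup G → ∀ r : Literature.MathematicalPhysics.QuantumFieldTheory.LatticeRep G, ∃ β₁ : ℝ, ∀ β : ℝ, β₁ ≤ β → ∀ ρ : ℝ, 0 < ρ → ∃ D : Set ℂ, IsOpen D ∧ IsConnected D ∧ (β : ℂ) ∈ D ∧ (∃ x : ℝ, |x| < ρ ∧ (x : ℂ) ∈ D) ∧ ∃ f : ℂ → ℂ, DifferentiableOn ℂ f D ∧ ∃ c : ℝ, 0 < c ∧ ∃ P₀ : ℕ, ∀ P : ℕ, P₀ ≤ P → ∀ z ∈ D, Literature.MathematicalPhysics.QuantumFieldTheory.wilsonFinTorusPartitionC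 r.ρ z P P P P ≠ 0 ∧ |Real.log ‖Literature.MathematicalPhysics.QuantumFieldTheory.wilsonFinTorusPartitionC r.ρ z P P P P‖ + (P : ℝ) ^ 4 * (f z).re| ≤ Real.exp (-(c * P))) ∧ (Summit.QuantumFields.YangMills.Theses.ComplexCouplingChannel.FreeEnergyWindowChannel ↔ ((∀ (G : Type) [Group G] [TopologicalSpace G] [IsTopologicalGroup G] [CompactSpace G] [MeasurableSpace G] [BorelSpace G], Literature.MathematicalPhysics.QuantumFieldTheory.IsCompactSimpleLieGroup G → ∀ r : Literature.MathematicalPhysics.QuantumFieldTheory.LatticeRep G, ∀ b : ℝ, ∃ βs : ℝ, b ≤ βs ∧ ∃ D : Set ℂ, IsOpen D ∧ IsConnected D ∧ (0 : ℂ) ∈ D ∧ ((βs : ℝ) : ℂ) ∈ D ∧ ∃ P₀ : ℕ, ∀ P : ℕ, P₀ ≤ P → ∀ z ∈ D, Literature.MathematicalPhysics.QuantumFieldTheory.wilsonFinTorusPartitionC r.ρ z P P P P ≠ 0) ∧ (∀ (G : Type) [Group G] [TopologicalSpace G] [IsTopologicalGroup G] [CompactSpace G] [MeasurableSpace G] [BorelSpace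 G], Literature.MathematicalPhysics.QuantumFieldTheory.IsCompactSimpleLieGroup G → ∀ r : Literature.MathematicalPhysics.QuantumFieldTheory.LatticeRep G, ∃ β₁ : ℝ, ∀ t : ℝ, β₁ ≤ t → ∃ C : ℝ, 0 < C ∧ ∃ P₀ : ℕ, ∀ P : ℕ, P₀ ≤ P → ∃ K : ℝ, ∀ n : ℕ, 1 ≤ n → |iteratedDeriv n (fun s : ℝ => Real.log (Literature.MathematicalPhysics.QuantumFieldTheory.wilsonFinTorusPartition r.ρ s P P P P)) t| ≤ K * n.factorial * C ^ n))) :=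
  ⟨freeEnergyWindowChannel_iff_expWindowChannel, freeEnergyWindowChannel_iff_reach_and_cumulantRadius⟩

end Summit.QuantumFields.YangMills.Theorems.FreeEnergyWindowChannel

end
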